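import Mathlib
import Literature.MathematicalPhysics.QuantumFieldTheory.YangMillsOS
import HarnessLib

/-!
# TwistSectorInputs

Topic `Literature/MathematicalPhysics/QuantumFieldTheory`. Named literature fact(s) relocated by the gate from `Summits/QuantumFields/YangMills/Theorems/SusceptibilityToPoincare/Negative/FalseOfTwistSectorInputs.lean`
(accept-time relocation of `[cite]`d propositions written inline in a Summits proposal; human ruling 2026-08-15).
Sources: BurgioEtAl2006, DeforcrandJahn2003, Thooft1979.

* `Literature.MathematicalPhysics.QuantumFieldTheory.TwistSectorInputs` — registered OPEN statement (`@[conjecture]`,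
  `OPEN CONJECTURE — … [status: open]`; literature-prover verdict `open-problem`, defact-verdict clean-up 2026-08-16:
  statement unchanged byte for byte, name kept because of its user
  `Summits/QuantumFields/YangMills/Theorems/SusceptibilityToPoincare/Negative/FalseOfTwistSectorInputs.lean`).

Status. `TwistSectorInputs` is a hypothesis bundle `H` minted by a refuter for a negative lemma (`H → ¬ crux`) and
relocated here by the gate; it is proved in NO source and is not literature debt: there is deliberately no
`TwistSectorInputs_holds`. What the cited sources contain (primary source read in full): Thooft1979 DEFINES the
electric/magnetic flux (twist) sectors of `SU(N)` gauge fields in a periodic box (§§2–5, pp. 143–148) and derives the exact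
`ℤ_N` duality equation (6.3) (§6, p. 149: "so far no approximation has been made … exact") — its only theorem-grade content;
its phase analysis then ASSUMES what conjunct (ii) encodes for the intended witness (§7.1, p. 149: "First let us assume that
no massless physical particles occur"; §7.2, p. 150: "From now on we will assume that the magnetic fluxes are light and the
electric ones heavy (confinement mode)"; §11, p. 158: "If electric confinement is assumed, then the energy of a magnetic flux
can be computed"). DeforcrandJahn2003 (§§4–5) and BurgioEtAl2006 (pp. 2–4) are Monte-Carlo studies of the SO(3) twist
sectors. None of them concerns the Wilson lattice measure's volume-uniform susceptibility (i) or heat-bath Dirichlet forms (iii).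
-/

namespace Literature.MathematicalPhysics.QuantumFieldTheory

open MeasureTheory ProbabilityTheory Filter Topology
open Literature.MathematicalPhysics.QuantumFieldTheory

/-- OPEN CONJECTURE — **`H = TwistSectorInputs`** ('t Hooft twist-sector inputs). There are: an admissible (`IsCompactSimpleLieGroup`)
but NOT simply connected compact gauge group `G`, a lattice representation `r`, a coupling `β ≥ 0` with
(i) finite gauge-invariant susceptibility uniformly in the volume (verbatim the hypothesis FS of
`FradkinShenkerFlow.SusceptibilityToPoincare`), and gauge-invariant measurable events `A S ⊆ G^{E(2S+1)}` on the tori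
of sides `2S+1` with (ii) Wilson mass in `[δ, 1 − δ]` for some `δ > 0` and (iii) single-link heat-bath boundary flux
`Σ_ℓ ∫∫ (1_{A S}(U) − 1_{A S}(U[ℓ ↦ g]))² dν_ℓ^U(g) dμ_{β,S}(U) → 0`, `ν_ℓ^U = Haar.tilted(−β S_W(U[ℓ ↦ ·]))`.
Intended inhabitant: `G = SO(3)`, `r = ρ₃`, `β` large, `A S` = the magnetic twist sector `{w₁₂ = 1}` away from large
ℤ₂-monopole clusters; (iii) = exact conservation of the twist class under single-link updates + a chessboard large-field
bound; (i), (ii) = weak-coupling mass gap and light magnetic flux of SO(3)₄ (open). Not constructible in the tree today.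
*Where posed / status.* OPEN — proved nowhere (see the module docstring for what Thooft1979 §§2–7, DeforcrandJahn2003
and BurgioEtAl2006 actually contain: definitions of the flux sectors, the exact duality (6.3), light magnetic flux ASSUMED
in §7.1–7.2, pp. 149–150, and Monte-Carlo evidence). Why no witness is available: for `β` in the high-temperature regime —
the only regime in which (i) is a theorem (strong-coupling cluster expansion) — the single-link heat bath satisfies a
volume-uniform Poincaré inequality (at `β = 0` it is the Efron–Stein inequality: the (iii)-sum equals
`2 Σ_ℓ E Var_ℓ(1_{A S}) ≥ 2 Var(1_{A S}) ≥ 2δ(1−δ)`), so (ii) ∧ (iii) has NO inhabitant there; any witness lives at larger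
`β`, where (i) is the volume-uniform clustering (lattice mass gap) of a 4D connected non-abelian compact simple gauge theory
and (ii), for the twist-sector event, is 't Hooft's light magnetic flux at weak coupling — both open (finite and abelian
`G`, where such results exist, are excluded by `IsCompactSimpleLieGroup`). Hence a registered open statement
(CONVENTIONS §4: `def … : Prop`, never asserted; deliberately no `TwistSectorInputs_holds`), taken as the explicit
hypothesis `(h : TwistSectorInputs)` by its user; its eventual home is an `@[conjecture]` obligation under
`Summits/QuantumFields/YangMills/Theorems/` (planner's call: crux or `conditional_on`). Statement unchanged; name kept.
[cite: Thooft1979, §§2–4 (electric and magnetic flux sectors on the torus)]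
[cite: DeforcrandJahn2003, §4 (twist observable η_μν, ℤ₂ monopoles in SO(3) LGT) and §5 (Metropolis non-ergodic across twist sectors beyond 4⁴)]
[cite: BurgioEtAl2006, pp. 2–4 (twists ±1 per configuration at weak coupling; barriers defeat local updates; F → 0 as T → 0)]
[topic MathematicalPhysics/QuantumFieldTheory] [status: open] -/
@[conjecture] def TwistSectorInputs : Prop :=
  ∃ (G : Type) (_ : Group G) (_ : TopologicalSpace G) (_ : IsTopologicalGroup G) (_ : CompactSpace G)
    (_ : MeasurableSpace G) (_ : BorelSpace G),
    IsCompactSimpleLieGroup G ∧ ¬ SimplyConnectedSpace G ∧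
    ∃ (r : LatticeRep G) (β : ℝ), 0 ≤ β ∧
    (∀ A B : YMSpecies G, ∃ χ : ℝ, ∀ S : ℕ, ∑ x ∈ Literature.Probability.LatticeModels.box 4 S,
      |covariance (fun U => A.F (Literature.MathematicalPhysics.QuantumLattice.torusLift (2 * S + 1) U))
        (fun U => B.F (Literature.MathematicalPhysics.QuantumLattice.configShift (-x)
            (Literature.MathematicalPhysics.QuantumLattice.torusLift (2 * S + 1) U)))
        (wilsonMeasure (d := 4) (L := 2 * S + 1) r.ρ β)| ≤ χ) ∧
    ∃ δ : ℝ, 0 < δ ∧ ∃ A : ∀ S : ℕ, Set (GaugeConfig 4 (2 * S + 1) G),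
      (∀ S, MeasurableSet (A S)) ∧
      (∀ S, IsGaugeInvariant ((A S).indicator (1 : GaugeConfig 4 (2 * S + 1) G → ℝ))) ∧
      (∀ S, δ ≤ (wilsonMeasure (d := 4) (L := 2 * S + 1) r.ρ β).real (A S) ∧
        (wilsonMeasure (d := 4) (L := 2 * S + 1) r.ρ β).real (A S) ≤ 1 - δ) ∧
      Tendsto (fun S : ℕ => ∑ ℓ : Edge 4 (2 * S + 1), ∫ U, ∫ g,
          ((A S).indicator (1 : GaugeConfig 4 (2 * S + 1) G → ℝ) U -
            (A S).indicator 1 (Function.update U ℓ g)) ^ 2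
        ∂((haarProbability G).tilted (fun g' => -β * wilsonAction r.ρ (Function.update U ℓ g')))
        ∂(wilsonMeasure (d := 4) (L := 2 * S + 1) r.ρ β)) atTop (𝓝 0)

end Literature.MathematicalPhysics.QuantumFieldTheory
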